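import Mathlib.Analysis.PSeries
import Literature.MathematicalPhysics.QuantumFieldTheory.Balaban1983to89.B4Eq19LatticeOperators
import HarnessLib

/-!
# Line «poincare_lipschitz» on crux `HistoryTailL` (stmt-QuantumFields-19936), K2 organ of record LOC-REG-MIN — E→R ROAD, BRICK F3 «MULTI-SCALE GOOD SHELL»:
# a finite multi-scale Chebyshev choice of ONE radius `r′` whose every shell carries little weight, SIMULTANEOUSLY at all scales

Cell `ym3-torus` (YM ladder rung R3 = continuum SU(2) Yang–Mills on the three-torus — a RUNG, NOT the Clay problem: not d = 4, not infinite volume, not a mass gap);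
width seat `ym3-torus-px8` gen 5 (★w5-19936 g12's LOCATE `E2R-ROAD-w5g12.md` §3 brick F3 «(S–M, finite Chebyshev over r′ ∈ [r∕2, 3r∕4]: for nonneg bond weights,
∃ r′ with E(shell_t(r′)) ≤ C k_t²·(t∕r)·E for all dyadic t simultaneously; needs only Σ_{r′} E(shell_t(r′)) ≤ 4t·E and Σ_k k⁻² ≤ 2)»; LEAD ym-ust-19936-w1 g8).
THEOREMS ONLY (def-free); `--supports stmt-QuantumFields-19936 --as helper`.  Nothing here proves E→R, LOC-REG-MIN, `hReg`, a stub, `BlockLipschitzL`, `HistoryTailL`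
or a summit statement.

* §1 ★ `exists_forall_card_mul_le` — ABSTRACT MULTI-SCALE CHEBYSHEV (Mathlib-only): finitely many candidates `r ∈ R`, finitely many scales `j ∈ J` with weights `w j > 0`,
  `Σ_j (w j)⁻¹ < 1`, nonneg loads `f j r` with `Σ_{r∈R} f j r ≤ M j` ⟹ ONE candidate is good at EVERY scale: `#R · f j r ≤ w j · M j` for all `j ∈ J`.  (Average of
  `g r := Σ_j f j r ∕ (w j M j)` is `< 1∕#R`; the `M j = 0` scales are trivial.)  `sum_inv_four_mul_sq_le` — the dyadic weights `w k := 4(k+1)²` have `Σ_{k<n} (w k)⁻¹ ≤ ½`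
  (Mathlib `sum_Ioo_inv_sq_le`, no `ζ(2)`); ★ `exists_forall_card_mul_le_sq` — the instance with those weights.
* §2 ★ `card_filter_mem_sdiff_le` — THE SLIDING-WINDOW COUNT: for a family of finsets `B : ℤ → Finset α` MONOTONE in the radius and margins `a ≤ b`, a fixed point `y` lies in
  the shell `B (r′ − a) \ B (r′ − b)` for at most `b − a` radii `r′`; ★★ `sum_sum_sdiff_le` — hence `Σ_{r′∈T} Σ_{y ∈ B(r′−a) \ B(r′−b)} c y ≤ (b − a) · Σ_{y ∈ U} c y` for
  nonneg `c` and any `U ⊇ B (r′ − a)` (`r′ ∈ T`) — the «`Σ_{r′} E(shell_t(r′)) ≤ 4t·E`» of the brick, with depth measured by the family itself (for lit ✓`box z ·` on `ℤᵈ`: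
  depth = ℓ^∞-distance to the complement, `y ∈ box z (r′ − a) \ box z (r′ − b) ⟺ r′ − b < ‖y − z‖_∞ ≤ r′ − a`).
* §3 ★★★ `exists_goodRadius` — F3 on lit ✓`B4Eq19LatticeOperators.box`: nonneg site weights `c` (e.g. `c y = Σ_μ ‖u(y+e_μ) − u y‖²`), candidate radii `T` (nonempty,
  e.g. `Icc ⌈r∕2⌉ ⌊3r∕4⌋`), scale margins `a k ≤ b k` (`k < n`; e.g. `a k = 2^k∕2 − 1`, `b k = 2^{k+1} − 1` for the shell `{2^{k−1} ≤ depth ≤ 2^{k+1}}`) with every shell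
  inside `box z r` ⟹ `∃ r′ ∈ T, ∀ k < n, #T · Σ_{y ∈ box z (r′ − a k) \ box z (r′ − b k)} c y ≤ 4(k+1)² · (b k − a k) · Σ_{y ∈ box z r} c y` — i.e. shell energy
  `≤ 16(k+1)²·(b k − a k)∕r · E` once `#T ≥ r∕4`: the printed `C·k_t²·(t∕r)·E` at `t = 2^k`, all scales at once.  `exists_goodRadius_family` — the same for any monotone
  family; `exists_goodRadius_Icc` — the instance `T = Icc p q` with `#T = q − p + 1` explicit; ★★ `exists_goodRadius_dyadic` — the depth bands `(2^k, 4·2^k]` ★w5-19936 g12's F4 reads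
  (`(q − p + 1)·Σ_{box z (r′−2^k) \ box z (r′−2^{k+2})} c ≤ 4(k+1)²·3·2^k·Σ_{box z r} c`).
[folklore] (Chebyshev ∕ pigeonhole over scales with summable weights: [SchoenUhlenbeck1982] §4 (choice of good radii), [Giaquinta1984] Ch. VI; the finite lattice statements
are this file's).
-/

set_option autoImplicit false

open scoped BigOperators
open Finset

namespace Summit.QuantumFields.YangMills.Theorems.PoincareLipschitzMultiScaleGoodShell

/-! ## §1 Abstract multi-scale Chebyshev -/

variable {ι κ : Type*}

/-- ★ **ABSTRACT MULTI-SCALE CHEBYSHEV.**  Finitely many candidates `R` (nonempty), finitely many scales `J` with weights `w j > 0` whose inverses sum to `< 1`, nonneg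
loads `f j r` with scale totals `Σ_{r∈R} f j r ≤ M j`: some candidate `r ∈ R` has `#R · f j r ≤ w j · M j` at EVERY scale `j ∈ J`. [folklore] -/
theorem exists_forall_card_mul_le (R : Finset κ) (hR : R.Nonempty) (J : Finset ι) (w M : ι → ℝ)
    (hw : ∀ j ∈ J, 0 < w j) (hsum : ∑ j ∈ J, (w j)⁻¹ < 1) (f : ι → κ → ℝ) (hf : ∀ j ∈ J, ∀ r ∈ R, 0 ≤ f j r)
    (hM : ∀ j ∈ J, ∑ r ∈ R, f j r ≤ M j) :
    ∃ r ∈ R, ∀ j ∈ J, (R.card : ℝ) * f j r ≤ w j * M j := by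
  classical
  set J' := J.filter (fun j => 0 < M j) with hJ'
  have hN : (0 : ℝ) < R.card := by exact_mod_cast hR.card_pos
  have hJ'sub : J' ⊆ J := Finset.filter_subset _ _
  have key : ∑ r ∈ R, (∑ j ∈ J', f j r / (w j * M j)) < ∑ _r ∈ R, (R.card : ℝ)⁻¹ := by
    rw [Finset.sum_comm]
    calc ∑ j ∈ J', ∑ r ∈ R, f j r / (w j * M j)
        = ∑ j ∈ J', (∑ r ∈ R, f j r) / (w j * M j) := by
          refine Finset.sum_congr rfl fun j _ => ?_
          rw [Finset.sum_div]
      _ ≤ ∑ j ∈ J', (w j)⁻¹ := by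
          refine Finset.sum_le_sum fun j hj => ?_
          have hjJ : j ∈ J := (Finset.mem_filter.1 hj).1
          have hMj : 0 < M j := (Finset.mem_filter.1 hj).2
          have hwj := hw j hjJ
          rw [div_le_iff₀ (mul_pos hwj hMj), inv_mul_cancel_left₀ hwj.ne']
          exact hM j hjJ
      _ ≤ ∑ j ∈ J, (w j)⁻¹ :=
          Finset.sum_le_sum_of_subset_of_nonneg hJ'sub fun j hj _ => (inv_pos.2 (hw j hj)).le
      _ < 1 := hsum
      _ = ∑ _r ∈ R, (R.card : ℝ)⁻¹ := by
          rw [Finset.sum_const, nsmul_eq_mul, mul_inv_cancel₀ hN.ne']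
  obtain ⟨r, hrR, hr⟩ := Finset.exists_lt_of_sum_lt key
  refine ⟨r, hrR, fun j hjJ => ?_⟩
  by_cases hMj : 0 < M j
  · have hjJ' : j ∈ J' := Finset.mem_filter.2 ⟨hjJ, hMj⟩
    have hwj := hw j hjJ
    have h1 : f j r / (w j * M j) ≤ ∑ i ∈ J', f i r / (w i * M i) :=
      Finset.single_le_sum (f := fun i => f i r / (w i * M i))
        (fun i hi => div_nonneg (hf i (hJ'sub hi) r hrR) (mul_pos (hw i (hJ'sub hi)) (Finset.mem_filter.1 hi).2).le) hjJ'
    have h2 : f j r / (w j * M j) < (R.card : ℝ)⁻¹ := h1.trans_lt hr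
    rw [div_lt_iff₀ (mul_pos hwj hMj)] at h2
    calc (R.card : ℝ) * f j r ≤ R.card * ((R.card : ℝ)⁻¹ * (w j * M j)) := mul_le_mul_of_nonneg_left h2.le hN.le
      _ = w j * M j := by rw [← mul_assoc, mul_inv_cancel₀ hN.ne', one_mul]
  · push Not at hMj
    have hnn : 0 ≤ ∑ r' ∈ R, f j r' := Finset.sum_nonneg fun r' hr' => hf j hjJ r' hr'
    have hM0 : M j = 0 := le_antisymm hMj (hnn.trans (hM j hjJ))
    have hs0 : ∑ r' ∈ R, f j r' = 0 := le_antisymm ((hM j hjJ).trans hMj) hnn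
    have hfz : f j r = 0 := (Finset.sum_eq_zero_iff_of_nonneg fun r' hr' => hf j hjJ r' hr').1 hs0 r hrR
    rw [hfz, hM0, mul_zero, mul_zero]

/-- The dyadic weights `w k := 4(k+1)²`: `Σ_{k<n} (4(k+1)²)⁻¹ ≤ ½` (from Mathlib's `Σ_{1<i<m} i⁻² ≤ 1`; no `ζ(2)` needed). [folklore] -/
theorem sum_inv_four_mul_sq_le (n : ℕ) : ∑ k ∈ Finset.range n, (4 * ((k : ℝ) + 1) ^ 2)⁻¹ ≤ 1 / 2 := by
  have h1 : ∑ k ∈ Finset.range n, (4 * ((k : ℝ) + 1) ^ 2)⁻¹ = (1 / 4) * ∑ i ∈ Finset.Ico 1 (n + 1), ((i : ℝ) ^ 2)⁻¹ := by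
    rw [Finset.sum_Ico_eq_sum_range, Finset.mul_sum]
    simp only [add_tsub_cancel_right, Nat.cast_add, Nat.cast_one, mul_inv, one_div]
    refine Finset.sum_congr rfl fun k _ => ?_
    ring
  have h2 : ∑ i ∈ Finset.Ico 1 (n + 1), ((i : ℝ) ^ 2)⁻¹ ≤ 2 := by
    rcases Nat.lt_or_ge (n + 1) 2 with hn | hn
    · interval_cases h : (n + 1) <;> simp
    · have h : Finset.Ico 1 (n + 1) = insert 1 (Finset.Ioo 1 (n + 1)) := by
        ext m; simp only [Finset.mem_Ico, Finset.mem_insert, Finset.mem_Ioo]; omega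
      rw [h, Finset.sum_insert (by simp)]
      have h3 := sum_Ioo_inv_sq_le (α := ℝ) 1 (n + 1)
      norm_num at h3 ⊢
      linarith
  rw [h1]; linarith

/-- ★ **MULTI-SCALE CHEBYSHEV, DYADIC WEIGHTS.**  With `w k = 4(k+1)²` over the scales `k < n`: some candidate `r ∈ R` has `#R · f k r ≤ 4(k+1)² · M k` for every `k < n`.
[folklore] -/
theorem exists_forall_card_mul_le_sq (R : Finset κ) (hR : R.Nonempty) (n : ℕ) (M : ℕ → ℝ) (f : ℕ → κ → ℝ)
    (hf : ∀ k < n, ∀ r ∈ R, 0 ≤ f k r) (hM : ∀ k < n, ∑ r ∈ R, f k r ≤ M k) :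
    ∃ r ∈ R, ∀ k < n, (R.card : ℝ) * f k r ≤ 4 * ((k : ℝ) + 1) ^ 2 * M k := by
  have hw : ∀ k ∈ Finset.range n, (0 : ℝ) < 4 * ((k : ℝ) + 1) ^ 2 := fun k _ => by positivity
  have hsum : ∑ k ∈ Finset.range n, (4 * ((k : ℝ) + 1) ^ 2)⁻¹ < 1 := (sum_inv_four_mul_sq_le n).trans_lt (by norm_num)
  obtain ⟨r, hrR, hr⟩ := exists_forall_card_mul_le R hR (Finset.range n) (fun k => 4 * ((k : ℝ) + 1) ^ 2) M hw hsum f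
    (fun k hk => hf k (Finset.mem_range.1 hk)) (fun k hk => hM k (Finset.mem_range.1 hk))
  exact ⟨r, hrR, fun k hk => hr k (Finset.mem_range.2 hk)⟩

/-! ## §2 The sliding-window count for shells of a monotone family -/

variable {α : Type*}

/-- ★ **SLIDING-WINDOW COUNT.**  If `B : ℤ → Finset α` is monotone in the radius and `a ≤ b`, a fixed point `y` lies in the shell `B (r′ − a) \ B (r′ − b)` for at most `b − a`
of the radii `r′ ∈ T`: membership at `r′` forces membership in `B (r″ − b)` for every `r″ ≥ r′ + (b − a)`. [folklore] -/
theorem card_filter_mem_sdiff_le [DecidableEq α] (B : ℤ → Finset α) (hB : Monotone B) {a b : ℤ} (hab : a ≤ b) (T : Finset ℤ) (y : α) :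
    ((T.filter fun r' => y ∈ B (r' - a) \ B (r' - b)).card : ℤ) ≤ b - a := by
  classical
  set S := T.filter fun r' => y ∈ B (r' - a) \ B (r' - b) with hS
  rcases S.eq_empty_or_nonempty with hS0 | hSne
  · rw [hS0, Finset.card_empty]; exact_mod_cast sub_nonneg.2 hab
  · set r₀ := S.min' hSne with hr₀
    have hsub : S ⊆ Finset.Ico r₀ (r₀ + (b - a)) := by
      intro r' hr'
      have hmin : r₀ ≤ r' := S.min'_le r' hr'
      have hr₀S : r₀ ∈ S := S.min'_mem hSne
      have hy₀ : y ∈ B (r₀ - a) := (Finset.mem_sdiff.1 (Finset.mem_filter.1 hr₀S).2).1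
      have hy' : y ∉ B (r' - b) := (Finset.mem_sdiff.1 (Finset.mem_filter.1 hr').2).2
      refine Finset.mem_Ico.2 ⟨hmin, ?_⟩
      by_contra hlt
      push Not at hlt
      exact hy' (hB (by linarith) hy₀)
    calc (S.card : ℤ) ≤ (Finset.Ico r₀ (r₀ + (b - a))).card := by exact_mod_cast Finset.card_le_card hsub
      _ = b - a := by rw [Int.card_Ico]; simp [Int.toNat_of_nonneg (sub_nonneg.2 hab)]

/-- ★★ **THE SHELL DOUBLE COUNT** («`Σ_{r′} E(shell(r′)) ≤ (width)·E`»).  For a monotone family `B`, margins `a ≤ b`, radii `T`, a finset `U` containing every outer set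
`B (r′ − a)` (`r′ ∈ T`), and nonneg weights `c` on `U`: `Σ_{r′∈T} Σ_{y ∈ B(r′−a) \ B(r′−b)} c y ≤ (b − a) · Σ_{y∈U} c y`. [folklore] -/
theorem sum_sum_sdiff_le [DecidableEq α] (B : ℤ → Finset α) (hB : Monotone B) {a b : ℤ} (hab : a ≤ b) (T : Finset ℤ) (U : Finset α)
    (hU : ∀ r' ∈ T, B (r' - a) ⊆ U) (c : α → ℝ) (hc : ∀ y ∈ U, 0 ≤ c y) :
    ∑ r' ∈ T, ∑ y ∈ B (r' - a) \ B (r' - b), c y ≤ ((b - a : ℤ) : ℝ) * ∑ y ∈ U, c y := by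
  classical
  have hstep : ∀ r' ∈ T, ∑ y ∈ B (r' - a) \ B (r' - b), c y = ∑ y ∈ U, (if y ∈ B (r' - a) \ B (r' - b) then c y else 0) := by
    intro r' hr'
    rw [← Finset.sum_filter]
    refine Finset.sum_congr ?_ fun _ _ => rfl
    ext y
    simp only [Finset.mem_filter, Finset.mem_sdiff]
    constructor
    · rintro ⟨h1, h2⟩; exact ⟨hU r' hr' h1, h1, h2⟩
    · rintro ⟨_, h1, h2⟩; exact ⟨h1, h2⟩
  rw [Finset.sum_congr rfl hstep, Finset.sum_comm, Finset.mul_sum]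
  refine Finset.sum_le_sum fun y hy => ?_
  rw [← Finset.sum_filter, Finset.sum_const, nsmul_eq_mul]
  have hcard := card_filter_mem_sdiff_le B hB hab T y
  have hcy := hc y hy
  calc ((T.filter fun r' => y ∈ B (r' - a) \ B (r' - b)).card : ℝ) * c y ≤ ((b - a : ℤ) : ℝ) * c y := by
        refine mul_le_mul_of_nonneg_right ?_ hcy
        exact_mod_cast hcard
    _ = ((b - a : ℤ) : ℝ) * c y := rfl

/-! ## §3 F3: the multi-scale good radius -/

/-- **F3 FOR A MONOTONE FAMILY.**  Candidates `T` (nonempty), scales `k < n` with margins `a k ≤ b k`, a finset `U ⊇ B (r′ − a k)` (`r′ ∈ T`, `k < n`), nonneg weights `c` on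
`U`: some `r′ ∈ T` has, at EVERY scale, `#T · Σ_{y ∈ B(r′−a k) \ B(r′−b k)} c y ≤ 4(k+1)² · (b k − a k) · Σ_{y∈U} c y`. [folklore] -/
theorem exists_goodRadius_family [DecidableEq α] (B : ℤ → Finset α) (hB : Monotone B) (T : Finset ℤ) (hT : T.Nonempty) (n : ℕ) (a b : ℕ → ℤ)
    (hab : ∀ k < n, a k ≤ b k) (U : Finset α) (hU : ∀ k < n, ∀ r' ∈ T, B (r' - a k) ⊆ U) (c : α → ℝ) (hc : ∀ y ∈ U, 0 ≤ c y) :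
    ∃ r' ∈ T, ∀ k < n, (T.card : ℝ) * ∑ y ∈ B (r' - a k) \ B (r' - b k), c y ≤ 4 * ((k : ℝ) + 1) ^ 2 * (((b k - a k : ℤ) : ℝ) * ∑ y ∈ U, c y) := by
  refine exists_forall_card_mul_le_sq T hT n (fun k => ((b k - a k : ℤ) : ℝ) * ∑ y ∈ U, c y)
    (fun k r' => ∑ y ∈ B (r' - a k) \ B (r' - b k), c y) (fun k hk r' hr' => ?_) (fun k hk => ?_)
  · exact Finset.sum_nonneg fun y hy => hc y (hU k hk r' hr' (Finset.mem_sdiff.1 hy).1)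
  · exact sum_sum_sdiff_le B hB (hab k hk) T U (hU k hk) c hc

open Literature.MathematicalPhysics.QuantumFieldTheory.Balaban1983to89 B4Eq19LatticeOperators in
/-- ★★★ **F3 «MULTI-SCALE GOOD SHELL» on `ℤᵈ`.**  Nonneg site weights `c` on `box z r` (e.g. the bond energy density `c y = Σ_μ ‖u(y+e_μ) − u y‖²`), candidate radii `T`
(nonempty; e.g. `Icc ⌈r∕2⌉ ⌊3r∕4⌋`), scale margins `a k ≤ b k` with every outer box inside `box z r` (`r′ − a k ≤ r`): ONE radius `r′ ∈ T` has, for EVERY scale `k < n`,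
`#T · Σ_{y ∈ box z (r′ − a k) \ box z (r′ − b k)} c y ≤ 4(k+1)² · (b k − a k) · Σ_{y ∈ box z r} c y` — with `t = 2^k`, `b k − a k ≍ t` and `#T ≥ r∕4` this is the printed
`E(shell_t(r′)) ≤ C·k_t²·(t∕r)·E`, all dyadic scales at once (depth = ℓ^∞-distance to the complement: `y ∈ box z (r′−a) \ box z (r′−b) ⟺ r′ − b < ‖y − z‖_∞ ≤ r′ − a`).
[folklore] [cite: SchoenUhlenbeck1982, §4] -/
theorem exists_goodRadius {d : ℕ} (z : Zd d) (r : ℤ) (T : Finset ℤ) (hT : T.Nonempty) (n : ℕ) (a b : ℕ → ℤ) (hab : ∀ k < n, a k ≤ b k)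
    (hTr : ∀ k < n, ∀ r' ∈ T, r' - a k ≤ r) (c : Zd d → ℝ) (hc : ∀ y ∈ box z r, 0 ≤ c y) :
    ∃ r' ∈ T, ∀ k < n, (T.card : ℝ) * ∑ y ∈ box z (r' - a k) \ box z (r' - b k), c y ≤ 4 * ((k : ℝ) + 1) ^ 2 * (((b k - a k : ℤ) : ℝ) * ∑ y ∈ box z r, c y) :=
  exists_goodRadius_family (box z) (fun _ _ h => box_mono z h) T hT n a b hab (box z r) (fun k hk r' hr' => box_mono z (hTr k hk r' hr')) c hc

open Literature.MathematicalPhysics.QuantumFieldTheory.Balaban1983to89 B4Eq19LatticeOperators in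
/-- **F3 ON AN INTERVAL OF RADII.**  The instance `T = Icc p q` (`p ≤ q`) of `exists_goodRadius`, with `#T = q − p + 1` made explicit: some `r′ ∈ [p, q]` has, for every scale
`k < n`, `(q − p + 1) · Σ_{y ∈ box z (r′ − a k) \ box z (r′ − b k)} c y ≤ 4(k+1)² · (b k − a k) · Σ_{y ∈ box z r} c y` (e.g. `p = ⌈r∕2⌉`, `q = ⌊3r∕4⌋`). [folklore] -/
theorem exists_goodRadius_Icc {d : ℕ} (z : Zd d) (r : ℤ) {p q : ℤ} (hpq : p ≤ q) (n : ℕ) (a b : ℕ → ℤ) (hab : ∀ k < n, a k ≤ b k)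
    (hqr : ∀ k < n, q - a k ≤ r) (c : Zd d → ℝ) (hc : ∀ y ∈ box z r, 0 ≤ c y) :
    ∃ r' ∈ Finset.Icc p q, ∀ k < n,
      ((q - p + 1 : ℤ) : ℝ) * ∑ y ∈ box z (r' - a k) \ box z (r' - b k), c y ≤ 4 * ((k : ℝ) + 1) ^ 2 * (((b k - a k : ℤ) : ℝ) * ∑ y ∈ box z r, c y) := by
  have hT : (Finset.Icc p q).Nonempty := Finset.nonempty_Icc.2 hpq
  have hcard : ((Finset.Icc p q).card : ℝ) = ((q - p + 1 : ℤ) : ℝ) := by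
    rw [Int.card_Icc]
    have h0 : (0 : ℤ) ≤ q + 1 - p := by linarith
    rw [show ((Int.toNat (q + 1 - p) : ℕ) : ℝ) = ((q + 1 - p : ℤ) : ℝ) by exact_mod_cast Int.toNat_of_nonneg h0]
    push_cast; ring
  obtain ⟨r', hr', h⟩ := exists_goodRadius z r (Finset.Icc p q) hT n a b hab
    (fun k hk r' hr' => by have := (Finset.mem_Icc.1 hr').2; linarith [hqr k hk]) c hc
  exact ⟨r', hr', fun k hk => hcard ▸ h k hk⟩

open Literature.MathematicalPhysics.QuantumFieldTheory.Balaban1983to89 B4Eq19LatticeOperators in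
/-- ★★ **F3, DYADIC DEPTH BANDS `(2^k, 4·2^k]` — the instance ★w5-19936 g12's F4 reads** (HOME/STATUS 2026-08-29 05:06:55Z (2)): radii `r′ ∈ Icc p q` with `q ≤ r`,
shells `box z (r′ − 2^k) \ box z (r′ − 2^(k+2))`, nonneg site weights `c` on `box z r`: ONE `r′` has, for every `k < n`,
`(q − p + 1) · Σ_{shell} c ≤ 4(k+1)² · (3·2^k) · Σ_{box z r} c`. [folklore] [cite: SchoenUhlenbeck1982, §4] -/
theorem exists_goodRadius_dyadic {d : ℕ} (z : Zd d) (r : ℤ) {p q : ℤ} (hpq : p ≤ q) (hq : q ≤ r) (n : ℕ)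
    (c : Zd d → ℝ) (hc : ∀ y ∈ box z r, 0 ≤ c y) :
    ∃ r' ∈ Finset.Icc p q, ∀ k < n,
      ((q - p + 1 : ℤ) : ℝ) * ∑ y ∈ box z (r' - (2 : ℤ) ^ k) \ box z (r' - (2 : ℤ) ^ (k + 2)), c y
        ≤ 4 * ((k : ℝ) + 1) ^ 2 * ((3 * (2 : ℝ) ^ k) * ∑ y ∈ box z r, c y) := by
  have hab : ∀ k < n, ((2 : ℤ) ^ k) ≤ (2 : ℤ) ^ (k + 2) := fun k _ => pow_le_pow_right₀ (by norm_num) (by omega)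
  have hqr : ∀ k < n, q - (2 : ℤ) ^ k ≤ r := fun k _ => by
    have : (0 : ℤ) < (2 : ℤ) ^ k := pow_pos (by norm_num) k
    linarith
  obtain ⟨r', hr', h⟩ := exists_goodRadius_Icc z r hpq n (fun k => (2 : ℤ) ^ k) (fun k => (2 : ℤ) ^ (k + 2)) hab hqr c hc
  refine ⟨r', hr', fun k hk => ?_⟩
  have hw : (((2 : ℤ) ^ (k + 2) - (2 : ℤ) ^ k : ℤ) : ℝ) = 3 * (2 : ℝ) ^ k := by push_cast; ring
  have := h k hk
  rwa [hw] at this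

end Summit.QuantumFields.YangMills.Theorems.PoincareLipschitzMultiScaleGoodShell
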